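import Literature.MathematicalPhysics.QuantumFieldTheory.Balaban1983to89.B9Thm310GTorusRegular
import Literature.MathematicalPhysics.QuantumFieldTheory.Balaban1983to89.B9Thm37GpTorusRegularEntries

/-!
# `Balaban1983to89.B9Thm310GTorusRegularEntries` — T. Bałaban, *Propagators for lattice gauge theories in a background field*, Commun. Math. Phys.
# **99** (1985) 389–434 [Balaban1985BackgroundPropagators], Theorem 3.10 (3.105)–(3.107) pp. 414–416 ⇒ the second, third and fourth inequalities (3.42)
# of Theorem 3.3 for `G(U) = Δ_a(U)⁻¹` AT def-Y's BOND CARRIER, and the four entries assembled into the (3.42) block of the reading `kernelFamilyBInv`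
# over the gauge-invariant test class — the bond-sector twin of p21's `B9Thm37GpTorusRegularEntries` (sub-row G-B9-LETTERS, module M5.7 FILE 2-B;
# FILE 1-B = `B9Thm310GTorusRegular` did the first entry)

statement-level skeleton of published theorems with citation tags; proofs where landed; nothing here is a claim about the Yang–Mills mass gap

PDF held: `paper:balaban1985-cmp99-background-propagators` (journal page = PDF page + 388); pp. 397, 399, 409–410, 414–416 read from the held text layer;
[4] = [Balaban1984PropagatorsII], Prop. 2.2 (2.64)–(2.67) p. 234.

THE PRINT.  p. 397 (3.42): *«|(G′(U)λ)(x)|, |(∇_U G′(U)λ)(x)|, |(G′(U)∇*_U λ)(x)|, |(Δ_U G′(U)λ)(x)| ≦ B₀[(Lʲη)², Lʲη, Lʲη, 1]e^{−δ₀d(y,y′)}|λ|»*; p. 399,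
Theorem 3.3: *«the operator G(U) (a = 1) satisfies the inequalities (3.42)–(3.47), with G′(U) replaced by G(U) and λ replaced by a function J defined at
bonds»*; p. 414 (3.105)–(3.106): *«Δ_aG₀ = I − … = I − R … For M sufficiently large this implies G = G₀(I − R)⁻¹ = Σ_{n=0}^∞ G₀Rⁿ»*; p. 416, Theorem 3.10:
*«The expansion converges in all the norms appearing in (3.42)–(3.47). … Theorem 3.10 implies Theorem 3.3»*; p. 410: *«The arguments are exactly the
same as in proofs of Proposition 1.2 [3] and Proposition 2.2 [4]»*; [4] p. 234 (after (2.66)): *«The similar inequalities hold for a derivative of G′λ and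
for a Hölder norm of a derivative, but with (Lʲη)² replaced by Lʲη and (Lʲη)^{1−α} correspondingly»*; p. 403: *«of course with different constants»*.

WHY THIS FILE (cell context: G-B9-LETTERS M5.7; FILE 1-B `B9Thm310GTorusRegular` did (3.42)₁ with the TOTAL remainder's majorant displayed, FILE 3-B
`B9Thm310CommutatorSum` summed its first family).  p21's M5.5 FILE 2 ran the p. 410 argument for the three remaining sup-entries at the SITE carrier with
unit weights: a LEFT factor `E` (`∇_U`, `Δ_U`) rides on the right fixed point `EG = EG₀ + (EG)R`, a RIGHT factor `F` (`∇*_U`) on the left fixed point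
`GF = G₀F + V(GF)` of the transposed identity, estimated by [4] (2.64)–(2.66) resp. r06's two-space weighted form
`B6RandomWalkHom.hom_majorant_of_leftFixedPoint_weighted`.  THIS FILE is the bond twin, in FILE 1-B's currency: NO unit weights (def-Y's bond functors
carry `c_f` inside `∇_U`, `∇*_U`, `Δ_U`: `B9CubeLettersInvWriteDictB`), the remainders supplied WHOLE — `R` of (3.105) with the majorant `Θ·e^{−δ₀d}` and
its transpose `V` of `B9Eq3105Coords.eq3105T_conj` with the SCALE-WEIGHTED majorant `θ_V·ℓ(a)ℓ(a′)⁻¹·e^{−δ₀d}` (the shape of r06's `rightR_cube_majorant`)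
— and def-Y's algebra VERBATIM: `GΔ_a = 1`, `Δ_aG = 1` (`conj_GAY_mul_deltaAY`, `conj_deltaAY_mul_GAY` from `IsUnit Δ_a(U)`), (3.105) and its transpose
in real coordinates (`eq3105_conj`, `eq3105T_conj`, under `IsUnit Δ_{a,□}(U)` for every cube and `ζ_□̃ = 1` on `supp h_□`).  §3 assembles the four
entries — FILE 1-B's `hasMajorant_conj_GAY_of_cubes`, the `d + 1` forward entries and the Laplacian entry (§2 left), the `d + 1` backward entries (§2
right) — at a common rate `(1 − 2α)δ₀` and the SUM constant, and WRITES them over the invariant class by `B9CubeLettersInvWriteDictB.eBlock_kernelFamilyBInv_of_hasMajorant`: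
★★★ `eBlock_kernelFamilyBInv_GAY_of_cubes` — `EBlock (kernelFamilyBInv i B cfg (GAY i parS parB Gp) par) (M₂(Σ_j‖b_j‖)·Bc) ((1−2α)δ₀) U₁`, ALL FOUR
INEQUALITIES (3.42) OF THEOREM 3.3 FOR def-Y's `G(U)` AT A GENERAL CONFIGURATION, modulo the displayed inputs.

DISPLAYED HYPOTHESES (named outputs of sibling modules; none a cited fact).  `hT`∕`hcnt` (FILE 1-B's, the cube terms' (3.42)₁ majorants — at the cover
of record FILE 1-B's `hT_of_eBlockInvB_cube` + p21's `hcnt_SQT`); `hR` (the total remainder: family 1 = FILE 3-B's `hasMajorant_sum_conj_KhBY_GACubeY_hTY`,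
families 2–4 = the p. 415 walk re-expansion of `P` ∕ (3.101), cell GAPS G-B9-05∕06a∕07); per direction `ν` the cube-term majorants `hTE ν` of
`conj b(D_ν)·(h_□·conj b G_□(U)·h_□)` and `hTF ν` of `(h_□·conj b G_□(U)·h_□)·conj b(D*_ν)`, and `hTL` of `conj b(Δ_U)·(h_□·conj b G_□(U)·h_□)` — Thm 3.3
entries 2–4 for `G_□(U)` through the cut-offs' Leibniz rules (p38's `B9Eq3104CutoffCommutators`, (3.100)–(3.104)) — with their summed bounds `hKE`, `hKF`,
`hKL`; `hV` (the transposed remainder's scale-weighted majorant); `hinvU : IsUnit Δ_a(U)` (M5.3 ∕ Thm 3.3's regime), `hinvC : ∀ □, IsUnit Δ_{a,□}(U)`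
(r05's `B9Thm311CubeLettersG`); [4] Lemma 2.1 at exponent `α` (`h261`, `h263`; the member's metric facts are theorems, p21's `geo_inputs_geo9K`); the
located smallness `Θc₁(α) < 1`, `θ_Vc₁(α) < 1` («for M sufficiently large»).  Nothing of the summation, of [4] Lemma 2.1 or of the dictionary is re-proved.

WHAT IS PROVED (all `theorem`s, 0 `def`, 0 sorry).  §1 (generic lattice `X`, geometry `g`) ★ `thm310_leftEntry`, ★ `thm310_rightEntry`; §2 (def-Y)
★★ `hasMajorant_left_conj_GAY_of_cubes`, ★★ `hasMajorant_right_conj_GAY_of_cubes`; §3 ★★★ `eBlock_kernelFamilyBInv_GAY_of_cubes`.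
HONEST SCOPE.  Entries (3.43)–(3.47) (Hölder, L², global) are not treated; nothing continuum ∕ OS ∕ mass gap ∕ Clay; YM mass gap NOT proved by any of
this (Track A conditional rung).  `--supports stmt-QuantumFields-19200`.  Net new unproved facts: 0.
-/

noncomputable section

namespace Literature.MathematicalPhysics.QuantumFieldTheory.Balaban1983to89.B9Thm310GTorusRegularEntries

open Node00 B9CubeLettersInvReadings
open B9CubeLettersInvWriteDictB (eBlock_kernelFamilyBInv_of_hasMajorant)
open B9Thm37GpTorusRegularEntries (kernel_mono)
open B6GlobalChartV1 (blkV1)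
open B6Ineq2142KLevelV1 (β)
open B6KLevelCensusIndexV1 (KIdx)
open B6Cover236MultiLevelBlocks (cubes)
open B6RandomWalk (HasMajorant Triangle254 Ineq261 Ineq263 hasMajorant_mono majorant_of_fixedPoint_266 c1_nonneg)
open B6RandomWalkHom (HasMajorantHom hasMajorantHom_iff hom_majorant_of_leftFixedPoint_weighted)
open B9Thm34Ext (toB6 toB6_dist)
open B9FromB6 (EBlock)
open B9GeoNormsKLevelV1 (geo9K)
open B9Eq352DivFormLetters (conj)
open B9Thm37Sum (mulOp fixedPoint_of_388 hasMajorant_finsetSum)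
open B9Thm37Glue (fixedPoint_of_388T)
open B9Thm37CubeCoverCommutators (cutMulY hTY)
open B9Eq3104CutoffCommutators (hBdY KhBY DPDsY)
open B9CubeLettersBondOpsL0 (deltaACubeY GACubeY)
open B9Eq3105AtLetters (DPDsCubeY P1CubeY)
open B9Eq3105Coords (eq3105_conj eq3105T_conj conj_GAY_mul_deltaAY conj_deltaAY_mul_GAY)
open B9Thm310GTorusRegular (thm310_entry1 hasMajorant_conj_GAY_of_cubes)
open scoped Matrix

/-! ## §1 [4] Prop. 2.2 for a LEFT and for a RIGHT factor, the remainders' majorants supplied whole — the summation behind «converges in all the norms» -/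

section Generic

variable {g : B9.Geometry} [Fintype g.Site] {R : ℝ} {H : Prop} {X : Type} [Fintype X] [DecidableEq X]

/-- ★ **A LEFT ENTRY OF (3.42) FROM (3.106), FOR ANY REAL-COORDINATE LEFT FACTOR `E`** ([4] p. 234 «with (Lʲη)² replaced by» the weight `W`): `G·Δ = 1`
(`hinv`), `Δ·Σ_□T_□ = 1 − R` ((3.105), `h388`), block majorants `K_{E,□}` of the cube terms `E·T_□` of `EG₀` whose sum is `≤ A·W(y)e^{−δ₀d(y,y′)}` (`hTE`,
`hKE`), the TOTAL remainder `R` with the majorant `Θ·e^{−δ₀d}` (`hR`), [4] Lemma 2.1 at exponent `α` and `Θc₁(α) < 1`: `E·G` has the majorant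
`A·c₁(α)(1 − Θc₁(α))⁻¹·W(y)·e^{−(1−α)δ₀d(y,y′)}` — `B6RandomWalk.majorant_of_fixedPoint_266` on the fixed point `EG = Σ_□ET_□ + (EG)R`.
[cite: Balaban1985BackgroundPropagators, (3.105)–(3.106) p.414, Thm 3.10 p.416, Thm 3.3 (3.42)₂,₄ pp.397–399; Balaban1984PropagatorsII, Prop. 2.2 (2.64)–(2.67) p.234] -/
theorem thm310_leftEntry (blk : X → g.Site) (d : ℕ) (δ₀ α Θ A : ℝ) {κ : Type} [Fintype κ]
    (Tl : κ → Module.End ℝ (X → ℝ)) {G' Δ Rt : Module.End ℝ (X → ℝ)} (Eb : Module.End ℝ (X → ℝ))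
    (W : g.Site → ℝ) (KE : κ → g.Site → g.Site → ℝ)
    (hA : 0 ≤ A) (hW : ∀ a, 0 ≤ W a) (hΘ : 0 ≤ Θ) (hαδ : 0 ≤ (1 - α) * δ₀)
    (htri : Triangle254 (toB6 g R H)) (hrefl : ∀ y : g.Site, g.dist y y = 0) (hdnn : ∀ y y' : g.Site, 0 ≤ g.dist y y')
    (h261 : Ineq261 d (toB6 g R H) δ₀ α) (h263 : Ineq263 d (toB6 g R H) δ₀ α) (hsmall : Θ * B6.c1 d δ₀ α < 1)
    (hTE : ∀ k, HasMajorant (g := toB6 g R H) blk (Eb * Tl k) (KE k))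
    (hKE : ∀ a a', (∑ k, KE k a a') ≤ A * W a * Real.exp (-(δ₀ * g.dist a a')))
    (hR : HasMajorant (g := toB6 g R H) blk Rt (fun (a a' : g.Site) => Θ * Real.exp (-(δ₀ * g.dist a a'))))
    (hinv : G' * Δ = 1) (h388 : Δ * (∑ k, Tl k) = 1 - Rt) :
    HasMajorant (g := toB6 g R H) blk (Eb * G')
      (fun (a a' : g.Site) => A * B6.c1 d δ₀ α * (1 - Θ * B6.c1 d δ₀ α)⁻¹ * W a * Real.exp (-((1 - α) * δ₀ * g.dist a a'))) := by
  -- EG₀ = Σ_□ E·T_□: the cube majorants add up ([4] p. 232 «A summation preserves it also»)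
  have hG0 : HasMajorant (g := toB6 g R H) blk (∑ k, Eb * Tl k) (fun (a a' : g.Site) => A * W a * Real.exp (-(δ₀ * g.dist a a'))) :=
    hasMajorant_mono (g := toB6 g R H) _ (hasMajorant_finsetSum (G := toB6 g R H) _ Finset.univ (fun k => Eb * Tl k) KE fun k _ => hTE k) hKE
  -- EG = EG₀ + (EG)R from G = G₀ + GR
  have hfix : Eb * G' = (∑ k, Eb * Tl k) + Eb * G' * Rt := by
    have h := fixedPoint_of_388 hinv h388
    conv_lhs => rw [h]
    rw [mul_add, Finset.mul_sum, ← mul_assoc]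
  have h := majorant_of_fixedPoint_266 (g := toB6 g R H) blk d δ₀ α Θ A W hA hW hΘ hαδ htri hrefl hdnn h261 h263 hsmall hG0 hR hfix
  refine hasMajorant_mono (g := toB6 g R H) blk h fun a a' => le_of_eq ?_
  simp only [toB6_dist]

/-- ★ **THE RIGHT ENTRY (3.42)₃ FROM (3.106) READ FROM THE LEFT, FOR ANY REAL-COORDINATE RIGHT FACTOR `F`** (the cell's reading of record for the right entry,
r06's `B9Thm37Glue` v4): `Δ·G = 1` (`hinvT`), the transposed identity `(Σ_□T_□)·Δ = 1 − V` (`h388T`), block majorants `K_{F,□}` of the cube terms `T_□·F` of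
`G₀F` whose sum is `≤ A·ℓ(y)e^{−δ₀d(y,y′)}` (`hTF`, `hKF`), the transposed remainder `V` with the SCALE-WEIGHTED majorant `θ·ℓ(y)ℓ(y′)⁻¹e^{−δ₀d(y,y′)}` (`hV`),
[4] Lemma 2.1 at exponent `α` (`0 ≤ αδ₀`, `0 ≤ (1−2α)δ₀`, `d` symmetric, `ℓ > 0`) and `θc₁(α) < 1`: `G·F` has the majorant
`A·c₁(α)(1 − θc₁(α))⁻¹·ℓ(y)·e^{−(1−2α)δ₀d(y,y′)}` — `B6RandomWalkHom.hom_majorant_of_leftFixedPoint_weighted` (`W = ℓ`, `Q ≡ 1`) on the left fixed point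
`GF = G₀F + V(GF)` (`B9Thm37Glue.fixedPoint_of_388T`). [cite: Balaban1985BackgroundPropagators, (3.105)–(3.106) p.414 (transposed), Thm 3.10 p.416, Thm 3.3 (3.42)₃ pp.397–399; Balaban1984PropagatorsII, Prop. 2.2 (2.65)–(2.67) p.234] -/
theorem thm310_rightEntry (blk : X → g.Site) (d : ℕ) (δ₀ α θ A : ℝ) {κ : Type} [Fintype κ]
    (Tl : κ → Module.End ℝ (X → ℝ)) {G' Δ Vt : Module.End ℝ (X → ℝ)} (Fb : Module.End ℝ (X → ℝ)) (KF : κ → g.Site → g.Site → ℝ)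
    (hA : 0 ≤ A) (hθ : 0 ≤ θ) (hαδ : 0 ≤ α * δ₀) (hαδ2 : 0 ≤ (1 - 2 * α) * δ₀)
    (htri : Triangle254 (toB6 g R H)) (hrefl : ∀ y : g.Site, g.dist y y = 0) (hsym : ∀ y y' : g.Site, g.dist y y' = g.dist y' y)
    (hdnn : ∀ y y' : g.Site, 0 ≤ g.dist y y') (hlenpos : ∀ y : g.Site, 0 < g.len y)
    (h261 : Ineq261 d (toB6 g R H) δ₀ α) (h263 : Ineq263 d (toB6 g R H) δ₀ α) (hsmall : θ * B6.c1 d δ₀ α < 1)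
    (hTF : ∀ k, HasMajorant (g := toB6 g R H) blk (Tl k * Fb) (KF k))
    (hKF : ∀ a a', (∑ k, KF k a a') ≤ A * g.len a * Real.exp (-(δ₀ * g.dist a a')))
    (hV : HasMajorant (g := toB6 g R H) blk Vt (fun (a a' : g.Site) => θ * g.len a * (g.len a')⁻¹ * Real.exp (-(δ₀ * g.dist a a'))))
    (hinvT : Δ * G' = 1) (h388T : (∑ k, Tl k) * Δ = 1 - Vt) :
    HasMajorant (g := toB6 g R H) blk (G' * Fb)
      (fun (a a' : g.Site) => A * B6.c1 d δ₀ α * (1 - θ * B6.c1 d δ₀ α)⁻¹ * g.len a * Real.exp (-((1 - 2 * α) * δ₀ * g.dist a a'))) := by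
  -- G₀F = Σ_□ T_□F: the cube majorants add up to the OUTPUT-weighted A·ℓ(a)·1·e^{−δ₀d}
  have hT₀ : HasMajorantHom (g := toB6 g R H) blk blk (∑ k, Tl k * Fb) (fun (a a' : g.Site) => A * g.len a * 1 * Real.exp (-(δ₀ * g.dist a a'))) :=
    (hasMajorantHom_iff (g := toB6 g R H) _ _ _).mpr
      (hasMajorant_mono (g := toB6 g R H) _ (hasMajorant_finsetSum (G := toB6 g R H) _ Finset.univ (fun k => Tl k * Fb) KF fun k _ => hTF k)
        fun a a' => by rw [mul_one]; exact hKF a a')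
  -- the left fixed point GF = G₀F + V(GF)
  have hfix : G' * Fb = (∑ k, Tl k * Fb) + Vt ∘ₗ (G' * Fb) := by
    have h := fixedPoint_of_388T hinvT h388T
    conv_lhs => rw [h]
    rw [add_mul, Finset.sum_mul, mul_assoc]
    rfl
  have htransfer : ∀ a a' : g.Site, (1 : ℝ) ≤ 1 * 1 * Real.exp (α * δ₀ * g.dist a a') := fun a a' => by
    rw [one_mul, one_mul]
    exact Real.one_le_exp (mul_nonneg hαδ (hdnn a a'))
  have h := hom_majorant_of_leftFixedPoint_weighted (g := toB6 g R H) blk blk d δ₀ α θ A 1 (fun y => g.len y) (fun _ => (1 : ℝ)) hA zero_le_one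
    hlenpos (fun _ => zero_le_one) hθ hαδ hαδ2 htri hrefl hsym hdnn h261 h263 hsmall htransfer hT₀ hV hfix
  refine hasMajorant_mono (g := toB6 g R H) _ ((hasMajorantHom_iff (g := toB6 g R H) _ _ _).mp h) fun a a' => le_of_eq ?_
  simp only [toB6_dist]
  ring

end Generic

variable {d ℓ : ℕ} {hd : 1 ≤ d + 1} {hL : Odd (ℓ + 1) ∧ 1 < ℓ + 1} {b₀ b₁ : ℝ}
variable {𝔸 : Type} [NormedRing 𝔸] [NormedAlgebra ℂ 𝔸] [CompleteSpace 𝔸]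
variable {ι : Type} [Fintype ι] [DecidableEq ι]
variable (i : KIdx d ℓ hd hL b₀ b₁) (b : Module.Basis ι ℝ 𝔸)
variable [Fintype (geo9K i).Site] [DecidableEq (geo9K i).Site] {Rr : ℝ} {Hp : Prop}
variable (ιB : BlkY i → IBondY i)

/-! ## §2 The left and right entries for def-Y's `G(U) = Δ_a(U)⁻¹` at the bond carrier, from (3.105) and its transpose in real coordinates -/

section DefY

omit [DecidableEq (geo9K i).Site] in
/-- ★★ **A LEFT ENTRY OF (3.42) FOR def-Y's `G(U)`, FOR ANY REAL-COORDINATE LEFT FACTOR `E`** (entries (3.42)₂ with `E = conj b(∇_{U,ν})`, weight `ℓ`, and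
(3.42)₄ with `E = conj b(Δ_U)`, weight `1`): def-Y's letters at `U` with `Δ_a(U)`, `Δ_{a,□}(U)` invertible, `ζ_□̃ = 1` on `supp h_□`; block majorants `K_{E,□}` of
`E·(h_□·conj b G_□(U)·h_□)` summing to `≤ A·W(a)e^{−δ₀d}` (`hTE`, `hKE`); the TOTAL remainder of (3.105) with the majorant `Θ·e^{−δ₀d}` (`hR`); [4] Lemma 2.1 at
exponent `α` and `Θc₁(α) < 1`: `E·conj b G(U)` has the majorant `A·c₁(α)(1 − Θc₁(α))⁻¹·W(a)·e^{−(1−α)δ₀d(a,a′)}` — `thm310_leftEntry` fed by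
`B9Eq3105Coords.conj_GAY_mul_deltaAY` and `eq3105_conj`. [cite: Balaban1985BackgroundPropagators, Thm 3.10 p.416 + (3.105)–(3.106) p.414 ⇒ Thm 3.3 (3.42)₂,₄ pp.397–399; Balaban1984PropagatorsII, Prop. 2.2 (2.67) p.234] -/
theorem hasMajorant_left_conj_GAY_of_cubes (d' : ℕ) {δ₀ α Θ A : ℝ}
    (parS : SiteParY 𝔸 i) (parB : BondParY 𝔸 i) (Gp : SiteOpY 𝔸 i) (U : CfgY 𝔸 i)
    (ζ : ↥(cubes i.D.toDomains) → SiteY i → ℝ) (hζ : ∀ c z, hTY i c z ≠ 0 → ζ c z = 1)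
    (hinvC : ∀ c : ↥(cubes i.D.toDomains), IsUnit (deltaACubeY i c parS parB U)) (hinvU : IsUnit (deltaAY i parS parB Gp U))
    (Eb : Module.End ℝ (FBondY i × ι → ℝ)) (W : (geo9K i).Site → ℝ) (KE : ↥(cubes i.D.toDomains) → (geo9K i).Site → (geo9K i).Site → ℝ)
    (hA : 0 ≤ A) (hW : ∀ a, 0 ≤ W a) (hΘ : 0 ≤ Θ) (hαδ : 0 ≤ (1 - α) * δ₀)
    (htri : Triangle254 (toB6 (geo9K i) Rr Hp)) (hrefl : ∀ y : (geo9K i).Site, (geo9K i).dist y y = 0)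
    (hdnn : ∀ y y' : (geo9K i).Site, 0 ≤ (geo9K i).dist y y')
    (h261 : Ineq261 d' (toB6 (geo9K i) Rr Hp) δ₀ α) (h263 : Ineq263 d' (toB6 (geo9K i) Rr Hp) δ₀ α)
    (hsmall : Θ * B6.c1 d' δ₀ α < 1)
    (hTE : ∀ c, HasMajorant (g := toB6 (geo9K i) Rr Hp) (fun p : FBondY i × ι => ιB (blkV1 i.hN i.D p.1))
      (Eb * (mulOp (fun p : FBondY i × ι => hBdY i (hTY i c) p.1) * conj b ((GACubeY i c parS parB U).restrictScalars ℝ) *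
        mulOp (fun p : FBondY i × ι => hBdY i (hTY i c) p.1))) (KE c))
    (hKE : ∀ a a', (∑ c, KE c a a') ≤ A * W a * Real.exp (-(δ₀ * (geo9K i).dist a a')))
    (hR : HasMajorant (g := toB6 (geo9K i) Rr Hp) (fun p : FBondY i × ι => ιB (blkV1 i.hN i.D p.1))
      ((∑ c, conj b ((KhBY i (hTY i c) parB U * GACubeY i c parS parB U * cutMulY (hBdY i (hTY i c))).restrictScalars ℝ))
        + ∑ c, conj b (((1 - cutMulY (hBdY i (ζ c))) * DPDsY i parS Gp U *
            (cutMulY (hBdY i (hTY i c)) * GACubeY i c parS parB U * cutMulY (hBdY i (hTY i c)))).restrictScalars ℝ)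
        + ∑ c, conj b ((cutMulY (hBdY i (ζ c)) * (DPDsY i parS Gp U - DPDsCubeY i c parS U) *
            (cutMulY (hBdY i (hTY i c)) * GACubeY i c parS parB U * cutMulY (hBdY i (hTY i c)))).restrictScalars ℝ)
        + ∑ c, conj b ((cutMulY (hBdY i (ζ c)) * P1CubeY i c (hTY i c) parS U * GACubeY i c parS parB U *
            cutMulY (hBdY i (hTY i c))).restrictScalars ℝ))
      (fun a a' => Θ * Real.exp (-(δ₀ * (geo9K i).dist a a')))) :
    HasMajorant (g := toB6 (geo9K i) Rr Hp) (fun p : FBondY i × ι => ιB (blkV1 i.hN i.D p.1))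
      (Eb * conj b ((GAY i parS parB Gp U).restrictScalars ℝ))
      (fun a a' => A * B6.c1 d' δ₀ α * (1 - Θ * B6.c1 d' δ₀ α)⁻¹ * W a * Real.exp (-((1 - α) * δ₀ * (geo9K i).dist a a'))) :=
  thm310_leftEntry (fun p : FBondY i × ι => ιB (blkV1 i.hN i.D p.1)) d' δ₀ α Θ A
    (fun c => mulOp (fun p : FBondY i × ι => hBdY i (hTY i c) p.1) * conj b ((GACubeY i c parS parB U).restrictScalars ℝ) *
      mulOp (fun p : FBondY i × ι => hBdY i (hTY i c) p.1))
    Eb W KE hA hW hΘ hαδ htri hrefl hdnn h261 h263 hsmall hTE hKE hR (conj_GAY_mul_deltaAY i b parS parB Gp U hinvU)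
    (eq3105_conj i b parS parB Gp U ζ hζ hinvC)

omit [DecidableEq (geo9K i).Site] in
/-- ★★ **THE RIGHT ENTRY (3.42)₃ FOR def-Y's `G(U)`, FOR ANY REAL-COORDINATE RIGHT FACTOR `F`** (`F = conj b(∇*_{U,ν})`): def-Y's letters at `U` with `Δ_a(U)`,
`Δ_{a,□}(U)` invertible, `ζ_□̃ = 1` on `supp h_□`; block majorants `K_{F,□}` of `(h_□·conj b G_□(U)·h_□)·F` summing to `≤ A·ℓ(a)e^{−δ₀d}` (`hTF`, `hKF`); the
TRANSPOSED remainder of (3.105) in real coordinates — `−Σ_□conj b(h_□G_□K(h_□)) − Σ_□conj b(h_□G_□P_{□,1}) + Σ_□conj b((h_□G_□h_□)ζ_□̃(DPD* − DP_□D*)) +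
Σ_□conj b((h_□G_□h_□)(1 − ζ_□̃)DPD*)`, the literal `V` of `B9Eq3105Coords.eq3105T_conj` — with the scale-weighted majorant `θ_V·ℓ(a)ℓ(a′)⁻¹e^{−δ₀d}` (`hV`);
[4] Lemma 2.1 at exponent `α` and `θ_Vc₁(α) < 1`: `conj b G(U)·F` has the majorant `A·c₁(α)(1 − θ_Vc₁(α))⁻¹·ℓ(a)·e^{−(1−2α)δ₀d(a,a′)}` — `thm310_rightEntry`
fed by `conj_deltaAY_mul_GAY` and `eq3105T_conj`. [cite: Balaban1985BackgroundPropagators, Thm 3.10 p.416 + (3.105) p.414 (transposed) ⇒ Thm 3.3 (3.42)₃ pp.397–399; Balaban1984PropagatorsII, Prop. 2.2 (2.67) p.234] -/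
theorem hasMajorant_right_conj_GAY_of_cubes (d' : ℕ) {δ₀ α θV A : ℝ}
    (parS : SiteParY 𝔸 i) (parB : BondParY 𝔸 i) (Gp : SiteOpY 𝔸 i) (U : CfgY 𝔸 i)
    (ζ : ↥(cubes i.D.toDomains) → SiteY i → ℝ) (hζ : ∀ c z, hTY i c z ≠ 0 → ζ c z = 1)
    (hinvC : ∀ c : ↥(cubes i.D.toDomains), IsUnit (deltaACubeY i c parS parB U)) (hinvU : IsUnit (deltaAY i parS parB Gp U))
    (Fb : Module.End ℝ (FBondY i × ι → ℝ)) (KF : ↥(cubes i.D.toDomains) → (geo9K i).Site → (geo9K i).Site → ℝ)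
    (hA : 0 ≤ A) (hθV : 0 ≤ θV) (hαδ : 0 ≤ α * δ₀) (hαδ2 : 0 ≤ (1 - 2 * α) * δ₀)
    (h261 : Ineq261 d' (toB6 (geo9K i) Rr Hp) δ₀ α) (h263 : Ineq263 d' (toB6 (geo9K i) Rr Hp) δ₀ α)
    (hsmall : θV * B6.c1 d' δ₀ α < 1)
    (hTF : ∀ c, HasMajorant (g := toB6 (geo9K i) Rr Hp) (fun p : FBondY i × ι => ιB (blkV1 i.hN i.D p.1))
      ((mulOp (fun p : FBondY i × ι => hBdY i (hTY i c) p.1) * conj b ((GACubeY i c parS parB U).restrictScalars ℝ) *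
        mulOp (fun p : FBondY i × ι => hBdY i (hTY i c) p.1)) * Fb) (KF c))
    (hKF : ∀ a a', (∑ c, KF c a a') ≤ A * (geo9K i).len a * Real.exp (-(δ₀ * (geo9K i).dist a a')))
    (hV : HasMajorant (g := toB6 (geo9K i) Rr Hp) (fun p : FBondY i × ι => ιB (blkV1 i.hN i.D p.1))
      (-(∑ c, conj b ((cutMulY (hBdY i (hTY i c)) * GACubeY i c parS parB U * KhBY i (hTY i c) parB U).restrictScalars ℝ))
        - ∑ c, conj b ((cutMulY (hBdY i (hTY i c)) * GACubeY i c parS parB U * P1CubeY i c (hTY i c) parS U).restrictScalars ℝ)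
        + ∑ c, conj b ((cutMulY (hBdY i (hTY i c)) * GACubeY i c parS parB U * cutMulY (hBdY i (hTY i c)) *
            (cutMulY (hBdY i (ζ c)) * (DPDsY i parS Gp U - DPDsCubeY i c parS U))).restrictScalars ℝ)
        + ∑ c, conj b ((cutMulY (hBdY i (hTY i c)) * GACubeY i c parS parB U * cutMulY (hBdY i (hTY i c)) *
            ((1 - cutMulY (hBdY i (ζ c))) * DPDsY i parS Gp U)).restrictScalars ℝ))
      (fun a a' => θV * (geo9K i).len a * ((geo9K i).len a')⁻¹ * Real.exp (-(δ₀ * (geo9K i).dist a a')))) :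
    HasMajorant (g := toB6 (geo9K i) Rr Hp) (fun p : FBondY i × ι => ιB (blkV1 i.hN i.D p.1))
      (conj b ((GAY i parS parB Gp U).restrictScalars ℝ) * Fb)
      (fun a a' => A * B6.c1 d' δ₀ α * (1 - θV * B6.c1 d' δ₀ α)⁻¹ * (geo9K i).len a *
        Real.exp (-((1 - 2 * α) * δ₀ * (geo9K i).dist a a'))) :=
  thm310_rightEntry (fun p : FBondY i × ι => ιB (blkV1 i.hN i.D p.1)) d' δ₀ α θV A
    (fun c => mulOp (fun p : FBondY i × ι => hBdY i (hTY i c) p.1) * conj b ((GACubeY i c parS parB U).restrictScalars ℝ) *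
      mulOp (fun p : FBondY i × ι => hBdY i (hTY i c) p.1))
    Fb KF hA hθV hαδ hαδ2 ((B9Thm34Ext.triangle254_toB6_iff (geo9K i) Rr Hp).2 (B9GeoLemma21KLevelV1.geo9K_dist_triangle i))
    (B9GeoLemma21KLevelV1.geo9K_dist_self i) (B9GeoLemma21KLevelV1.geo9K_dist_comm i) (B9GeoLemma21KLevelV1.geo9K_dist_nonneg' i)
    (B9GeoLemma21KLevelV1.geo9K_len_pos i) h261 h263 hsmall hTF hKF hV (conj_deltaAY_mul_GAY i b parS parB Gp U hinvU)
    (eq3105T_conj i b parS parB Gp U ζ hζ hinvC)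

end DefY

/-! ## §3 All four entries of (3.42) for def-Y's `G(U)` assembled and WRITTEN over the invariant class: the block `EBlock (kernelFamilyBInv …)` at `U₁` -/

section Assembly

variable {B : B9.Backgrounds} (cfg : B.Cfg → CfgY 𝔸 i) (par : BondParY 𝔸 i) {U₁ : B.Cfg}

/-- ★★★ **THEOREM 3.10 ⇒ ALL FOUR INEQUALITIES (3.42) OF THEOREM 3.3 FOR def-Y's `G(U)` AT A GENERAL CONFIGURATION, AS THE (3.42) BLOCK OF THE READING
`kernelFamilyBInv i B cfg (GAY i parS parB Gp) par` OVER THE INVARIANT CLASS AT `U₁`** (p. 416 «The expansion converges in all the norms appearing in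
(3.42)–(3.47). … Theorem 3.10 implies Theorem 3.3»; here the four sup-entries (3.42)).  With ANY ℝ-linear letters `D_ν`, `D*_ν`, `L` agreeing pointwise with
def-Y's `∇_{U,ν}` (`cdB`), `∇*_{U,ν}` (`cdsB`), `Δ_U` (`lapB`) at `U = cfg U₁`: FILE 1-B's first entry (inputs `hT`∕`hcnt`), the `d + 1` forward entries and the
Laplacian entry (§2 left; inputs `hTE ν`∕`hKE ν` with weight `ℓ`, constant `A₁`, `hTL`∕`hKL` with weight `1`, constant `A₃`), the `d + 1` backward entries (§2
right; inputs `hTF ν`∕`hKF ν`, constant `A₂`, the transposed remainder's `hV` with `θ_V`), the total remainder's `hR` with `Θ`, `IsUnit Δ_a(U)`, `IsUnit Δ_{a,□}(U)`,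
`ζ_□̃ = 1` on `supp h_□`, [4] Lemma 2.1 at exponent `α` (`h261`, `h263`; the member's metric facts are theorems) and the two located smallness conditions give,
through `B9CubeLettersInvWriteDictB.eBlock_kernelFamilyBInv_of_hasMajorant` (basis `b`, coordinate bound `M₂`, corner-free section `ιB` of `β`), the block
`EBlock (kernelFamilyBInv i B cfg (GAY i parS parB Gp) par) (M₂(Σ_j‖b_j‖)·Bc) ((1−2α)δ₀) U₁` with
`Bc = (N·B₀ + A₁ + A₃)·c₁(α)(1 − Θc₁(α))⁻¹ + A₂·c₁(α)(1 − θ_Vc₁(α))⁻¹` written term by term (p. 403 «of course with different constants»).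
[cite: Balaban1985BackgroundPropagators, Thm 3.3 p.399 (3.42) p.397 via Thm 3.10 pp.414–416; Balaban1984PropagatorsII, Prop. 2.2 (2.67) p.234] -/
theorem eBlock_kernelFamilyBInv_GAY_of_cubes (hι : ∀ s, β i.hN i.D i.hk (ιB s) = s)
    {M₂ : ℝ} (hM₂ : 0 ≤ M₂) (hrepr : ∀ (v : 𝔸) (j : ι), |b.repr v j| ≤ M₂ * ‖v‖)
    (parS : SiteParY 𝔸 i) (parB : BondParY 𝔸 i) (Gp : SiteOpY 𝔸 i)
    (ζ : ↥(cubes i.D.toDomains) → SiteY i → ℝ) (hζ : ∀ c z, hTY i c z ≠ 0 → ζ c z = 1)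
    (hinvC : ∀ c : ↥(cubes i.D.toDomains), IsUnit (deltaACubeY i c parS parB (cfg U₁))) (hinvU : IsUnit (deltaAY i parS parB Gp (cfg U₁)))
    (D Ds : Fin (d + 1) → Module.End ℝ (FBondY i → 𝔸)) (hD : ∀ ν Λ, D ν Λ = cdB i (cfg U₁) ν Λ) (hDs : ∀ ν Λ, Ds ν Λ = cdsB i (cfg U₁) ν Λ)
    (Lp : Module.End ℝ (FBondY i → 𝔸)) (hLp : ∀ Λ, Lp Λ = lapB i (cfg U₁) Λ)
    (d' : ℕ) {δ₀ α Θ θV B₀ N A₁ A₂ A₃ : ℝ}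
    (S : ↥(cubes i.D.toDomains) → Finset (geo9K i).Site)
    (KE KF : Fin (d + 1) → ↥(cubes i.D.toDomains) → (geo9K i).Site → (geo9K i).Site → ℝ)
    (KL : ↥(cubes i.D.toDomains) → (geo9K i).Site → (geo9K i).Site → ℝ)
    (hB₀ : 0 ≤ B₀) (hΘ : 0 ≤ Θ) (hθV : 0 ≤ θV) (hN : 0 ≤ N) (hA₁ : 0 ≤ A₁) (hA₂ : 0 ≤ A₂) (hA₃ : 0 ≤ A₃)
    (hαδ : 0 ≤ α * δ₀) (hαδ2 : 0 ≤ (1 - 2 * α) * δ₀)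
    (h261 : Ineq261 d' (toB6 (geo9K i) Rr Hp) δ₀ α) (h263 : Ineq263 d' (toB6 (geo9K i) Rr Hp) δ₀ α)
    (hsmall : Θ * B6.c1 d' δ₀ α < 1) (hsmallV : θV * B6.c1 d' δ₀ α < 1)
    (hT : ∀ c, HasMajorant (g := toB6 (geo9K i) Rr Hp) (fun p : FBondY i × ι => ιB (blkV1 i.hN i.D p.1))
      (mulOp (fun p : FBondY i × ι => hBdY i (hTY i c) p.1) * conj b ((GACubeY i c parS parB (cfg U₁)).restrictScalars ℝ) *
        mulOp (fun p : FBondY i × ι => hBdY i (hTY i c) p.1))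
      (fun a a' => if a ∈ S c then B₀ * (geo9K i).len a ^ 2 * Real.exp (-(δ₀ * (geo9K i).dist a a')) else 0))
    (hcnt : ∀ a : (geo9K i).Site, (∑ c, if a ∈ S c then (1 : ℝ) else 0) ≤ N)
    (hR : HasMajorant (g := toB6 (geo9K i) Rr Hp) (fun p : FBondY i × ι => ιB (blkV1 i.hN i.D p.1))
      ((∑ c, conj b ((KhBY i (hTY i c) parB (cfg U₁) * GACubeY i c parS parB (cfg U₁) * cutMulY (hBdY i (hTY i c))).restrictScalars ℝ))
        + ∑ c, conj b (((1 - cutMulY (hBdY i (ζ c))) * DPDsY i parS Gp (cfg U₁) *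
            (cutMulY (hBdY i (hTY i c)) * GACubeY i c parS parB (cfg U₁) * cutMulY (hBdY i (hTY i c)))).restrictScalars ℝ)
        + ∑ c, conj b ((cutMulY (hBdY i (ζ c)) * (DPDsY i parS Gp (cfg U₁) - DPDsCubeY i c parS (cfg U₁)) *
            (cutMulY (hBdY i (hTY i c)) * GACubeY i c parS parB (cfg U₁) * cutMulY (hBdY i (hTY i c)))).restrictScalars ℝ)
        + ∑ c, conj b ((cutMulY (hBdY i (ζ c)) * P1CubeY i c (hTY i c) parS (cfg U₁) * GACubeY i c parS parB (cfg U₁) *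
            cutMulY (hBdY i (hTY i c))).restrictScalars ℝ))
      (fun a a' => Θ * Real.exp (-(δ₀ * (geo9K i).dist a a'))))
    (hTE : ∀ ν c, HasMajorant (g := toB6 (geo9K i) Rr Hp) (fun p : FBondY i × ι => ιB (blkV1 i.hN i.D p.1))
      (conj b (D ν) * (mulOp (fun p : FBondY i × ι => hBdY i (hTY i c) p.1) * conj b ((GACubeY i c parS parB (cfg U₁)).restrictScalars ℝ) *
        mulOp (fun p : FBondY i × ι => hBdY i (hTY i c) p.1))) (KE ν c))
    (hKE : ∀ ν a a', (∑ c, KE ν c a a') ≤ A₁ * (geo9K i).len a * Real.exp (-(δ₀ * (geo9K i).dist a a')))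
    (hTL : ∀ c, HasMajorant (g := toB6 (geo9K i) Rr Hp) (fun p : FBondY i × ι => ιB (blkV1 i.hN i.D p.1))
      (conj b Lp * (mulOp (fun p : FBondY i × ι => hBdY i (hTY i c) p.1) * conj b ((GACubeY i c parS parB (cfg U₁)).restrictScalars ℝ) *
        mulOp (fun p : FBondY i × ι => hBdY i (hTY i c) p.1))) (KL c))
    (hKL : ∀ a a', (∑ c, KL c a a') ≤ A₃ * 1 * Real.exp (-(δ₀ * (geo9K i).dist a a')))
    (hTF : ∀ ν c, HasMajorant (g := toB6 (geo9K i) Rr Hp) (fun p : FBondY i × ι => ιB (blkV1 i.hN i.D p.1))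
      ((mulOp (fun p : FBondY i × ι => hBdY i (hTY i c) p.1) * conj b ((GACubeY i c parS parB (cfg U₁)).restrictScalars ℝ) *
        mulOp (fun p : FBondY i × ι => hBdY i (hTY i c) p.1)) * conj b (Ds ν)) (KF ν c))
    (hKF : ∀ ν a a', (∑ c, KF ν c a a') ≤ A₂ * (geo9K i).len a * Real.exp (-(δ₀ * (geo9K i).dist a a')))
    (hV : HasMajorant (g := toB6 (geo9K i) Rr Hp) (fun p : FBondY i × ι => ιB (blkV1 i.hN i.D p.1))
      (-(∑ c, conj b ((cutMulY (hBdY i (hTY i c)) * GACubeY i c parS parB (cfg U₁) * KhBY i (hTY i c) parB (cfg U₁)).restrictScalars ℝ))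
        - ∑ c, conj b ((cutMulY (hBdY i (hTY i c)) * GACubeY i c parS parB (cfg U₁) * P1CubeY i c (hTY i c) parS (cfg U₁)).restrictScalars ℝ)
        + ∑ c, conj b ((cutMulY (hBdY i (hTY i c)) * GACubeY i c parS parB (cfg U₁) * cutMulY (hBdY i (hTY i c)) *
            (cutMulY (hBdY i (ζ c)) * (DPDsY i parS Gp (cfg U₁) - DPDsCubeY i c parS (cfg U₁)))).restrictScalars ℝ)
        + ∑ c, conj b ((cutMulY (hBdY i (hTY i c)) * GACubeY i c parS parB (cfg U₁) * cutMulY (hBdY i (hTY i c)) *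
            ((1 - cutMulY (hBdY i (ζ c))) * DPDsY i parS Gp (cfg U₁))).restrictScalars ℝ))
      (fun a a' => θV * (geo9K i).len a * ((geo9K i).len a')⁻¹ * Real.exp (-(δ₀ * (geo9K i).dist a a')))) :
    EBlock (kernelFamilyBInv i B cfg (GAY i parS parB Gp) par)
      (M₂ * (∑ j, ‖b j‖) *
        (N * B₀ * B6.c1 d' δ₀ α * (1 - Θ * B6.c1 d' δ₀ α)⁻¹ + A₁ * B6.c1 d' δ₀ α * (1 - Θ * B6.c1 d' δ₀ α)⁻¹ +
          A₂ * B6.c1 d' δ₀ α * (1 - θV * B6.c1 d' δ₀ α)⁻¹ + A₃ * B6.c1 d' δ₀ α * (1 - Θ * B6.c1 d' δ₀ α)⁻¹))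
      ((1 - 2 * α) * δ₀) U₁ := by
  -- the member's metric facts (theorems of the k-level V1 family)
  have htri : Triangle254 (toB6 (geo9K i) Rr Hp) :=
    (B9Thm34Ext.triangle254_toB6_iff (geo9K i) Rr Hp).2 (B9GeoLemma21KLevelV1.geo9K_dist_triangle i)
  have hrefl := B9GeoLemma21KLevelV1.geo9K_dist_self i
  have hdnn := B9GeoLemma21KLevelV1.geo9K_dist_nonneg' i
  have hlenpos := B9GeoLemma21KLevelV1.geo9K_len_pos i
  have hαδ1 : 0 ≤ (1 - α) * δ₀ := by linarith
  -- abbreviations for the constants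
  set c : ℝ := B6.c1 d' δ₀ α with hc
  have hc0 : 0 ≤ c := c1_nonneg d' δ₀ α
  have hinv0 : 0 ≤ (1 - Θ * c)⁻¹ := inv_nonneg.mpr (by linarith)
  have hinvV : 0 ≤ (1 - θV * c)⁻¹ := inv_nonneg.mpr (by linarith)
  have hC₀ : 0 ≤ N * B₀ * c * (1 - Θ * c)⁻¹ := mul_nonneg (mul_nonneg (mul_nonneg hN hB₀) hc0) hinv0
  have hC₁ : 0 ≤ A₁ * c * (1 - Θ * c)⁻¹ := mul_nonneg (mul_nonneg hA₁ hc0) hinv0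
  have hC₂ : 0 ≤ A₂ * c * (1 - θV * c)⁻¹ := mul_nonneg (mul_nonneg hA₂ hc0) hinvV
  have hC₃ : 0 ≤ A₃ * c * (1 - Θ * c)⁻¹ := mul_nonneg (mul_nonneg hA₃ hc0) hinv0
  set Bc : ℝ := N * B₀ * c * (1 - Θ * c)⁻¹ + A₁ * c * (1 - Θ * c)⁻¹ + A₂ * c * (1 - θV * c)⁻¹ + A₃ * c * (1 - Θ * c)⁻¹ with hBc
  have hBc0 : 0 ≤ Bc := by positivity
  have hle₀ : N * B₀ * c * (1 - Θ * c)⁻¹ ≤ Bc := by linarith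
  have hle₁ : A₁ * c * (1 - Θ * c)⁻¹ ≤ Bc := by linarith
  have hle₂ : A₂ * c * (1 - θV * c)⁻¹ ≤ Bc := by linarith
  have hle₃ : A₃ * c * (1 - Θ * c)⁻¹ ≤ Bc := by linarith
  have hrate : ∀ a a' : (geo9K i).Site, (1 - 2 * α) * δ₀ * (geo9K i).dist a a' ≤ (1 - α) * δ₀ * (geo9K i).dist a a' := fun a a' => by
    have h := mul_nonneg hαδ (hdnn a a')
    nlinarith
  -- the letter at `cfg U₁`
  set G : Module.End ℝ (FBondY i → 𝔸) := (GAY i parS parB Gp (cfg U₁)).restrictScalars ℝ with hG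
  -- entry 1 (FILE 1-B), entries 2 and 4 (§2 left), entry 3 (§2 right)
  have h0 := hasMajorant_conj_GAY_of_cubes i b ιB d' parS parB Gp (cfg U₁) ζ hζ hinvC hinvU S hB₀ hΘ hN hαδ1 htri hrefl hdnn h261 h263
    hsmall hT hcnt hR
  have h1 : ∀ ν : Fin (d + 1), HasMajorant (g := toB6 (geo9K i) Rr Hp) (fun p : FBondY i × ι => ιB (blkV1 i.hN i.D p.1))
      (conj b (D ν) * conj b G)
      (fun a a' => A₁ * c * (1 - Θ * c)⁻¹ * (geo9K i).len a * Real.exp (-((1 - α) * δ₀ * (geo9K i).dist a a'))) := fun ν =>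
    hasMajorant_left_conj_GAY_of_cubes i b ιB d' parS parB Gp (cfg U₁) ζ hζ hinvC hinvU (conj b (D ν)) (fun a => (geo9K i).len a) (KE ν)
      hA₁ (fun a => (hlenpos a).le) hΘ hαδ1 htri hrefl hdnn h261 h263 hsmall (hTE ν) (hKE ν) hR
  have h3 : HasMajorant (g := toB6 (geo9K i) Rr Hp) (fun p : FBondY i × ι => ιB (blkV1 i.hN i.D p.1)) (conj b Lp * conj b G)
      (fun a a' => A₃ * c * (1 - Θ * c)⁻¹ * 1 * Real.exp (-((1 - α) * δ₀ * (geo9K i).dist a a'))) :=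
    hasMajorant_left_conj_GAY_of_cubes i b ιB d' parS parB Gp (cfg U₁) ζ hζ hinvC hinvU (conj b Lp) (fun _ => (1 : ℝ)) KL
      hA₃ (fun _ => zero_le_one) hΘ hαδ1 htri hrefl hdnn h261 h263 hsmall hTL hKL hR
  have h2 : ∀ ν : Fin (d + 1), HasMajorant (g := toB6 (geo9K i) Rr Hp) (fun p : FBondY i × ι => ιB (blkV1 i.hN i.D p.1))
      (conj b G * conj b (Ds ν))
      (fun a a' => A₂ * c * (1 - θV * c)⁻¹ * (geo9K i).len a * Real.exp (-((1 - 2 * α) * δ₀ * (geo9K i).dist a a'))) := fun ν =>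
    hasMajorant_right_conj_GAY_of_cubes i b ιB d' parS parB Gp (cfg U₁) ζ hζ hinvC hinvU (conj b (Ds ν)) (KF ν) hA₂ hθV hαδ hαδ2 h261 h263
      hsmallV (hTF ν) (hKF ν) hV
  -- common constant `Bc`, common rate `(1 − 2α)δ₀`, and the dictionary
  refine eBlock_kernelFamilyBInv_of_hasMajorant i b cfg (GAY i parS parB Gp) par (Rr := Rr) (Hp := Hp) ιB hι hM₂ hrepr G (fun _ => rfl)
    D Ds hD hDs Lp hLp hBc0 ?_ ?_ ?_ ?_
  · exact hasMajorant_mono (g := toB6 (geo9K i) Rr Hp) _ h0 fun a a' => kernel_mono hle₀ hBc0 (sq_nonneg _) (hrate a a')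
  · exact fun ν => hasMajorant_mono (g := toB6 (geo9K i) Rr Hp) _ (h1 ν) fun a a' => kernel_mono hle₁ hBc0 (hlenpos a).le (hrate a a')
  · exact fun ν => hasMajorant_mono (g := toB6 (geo9K i) Rr Hp) _ (h2 ν) fun a a' => kernel_mono hle₂ hBc0 (hlenpos a).le le_rfl
  · exact hasMajorant_mono (g := toB6 (geo9K i) Rr Hp) _ h3 fun a a' => kernel_mono hle₃ hBc0 zero_le_one (hrate a a')

end Assembly

end Literature.MathematicalPhysics.QuantumFieldTheory.Balaban1983to89.B9Thm310GTorusRegularEntries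

end
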